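import Summits.NavierStokesRegularity.NavierStokesRegularity.Theorems.TaoForcedUniqueness.Negative.SerrinEnstrophyForce

/-!
# KJ-6 (5/9): the weak form of the witness is VOID (K54 (4) verbatim) — `uW_weakForm`, `uW_weak`

Cell `ns-blowup`, seat `ns-blowup-refuter` (g10 blueprint, g11 kernel), KILLSHEET §XXIV rows KJ-6/KJ-7,
part 5/9 of the kernel certificate `¬ Literature.Analysis.FluidPDE.Sohr2001_serrinClass_enstrophyBound(_global)`
(final file `SohrSerrinEnstrophyCountableJunk.lean` in this directory, which carries the full account and the
classification). LABEL: refuter construction (explicit data + proved lemmas; no named facts, no `sorry`).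
WHAT THIS IS NOT: not Navier–Stokes evidence and not a statement about Sohr's printed theorem — a hygiene
refutation of two facts AS TYPED (slice-wise force class `MemLqLp 2 2`, one outer Bochner integral in the
weak form); nothing here mentions the summit.

Content: `eq_zero_of_eq_smul_dilate` (a compactly supported `a • U_c`, `c > 0`, is `0`: `Profile.far`); joint
continuity of the slice derivatives / slice Laplacian of a space–time test field; the honest part of the
weak-form integrand is integrable in `x` for each `t` and jointly measurable (`measurable_uW`); the junk pairings
`t ↦ ∫⟪Φ_{λ(t),m}, ψ t⟫` are measurable (`J.measurable`); and THE VOID WEAK FORM `uW_weakForm` (refuter4's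
`CountableJunkForce.weak_identity_flow` adapted to the time-dependent dilate): the slice integrand is
`H(t) + P(ℓ(t), t)` with `H`, `P(m, ·)` measurable and `P(0, ·) = 0`; if it is a.e.-strongly measurable on
`(0,T)` the labelling lemma `ae_eq_of_aestronglyMeasurable_label` (`SaturatedPartition.lean`) and totality force
`ψ ≡ 0` on `(0,T)` (so the integrand vanishes), otherwise the Bochner integral is `0` by convention. Hence
`uW_weak : IsWeakNSSolutionOn T ν f 0 u`.
-/

noncomputable section

namespace Summit.NavierStokesRegularity.ForcedUniquenessHygiene.KJ6

open MeasureTheory Set Function Filter Topology Metric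
open scoped ENNReal NNReal RealInnerProductSpace ContDiff Laplacian
open Literature.Analysis.FluidPDE Literature.Analysis.FunctionSpaces

variable {Pr : Profile} (J : JunkFamily Pr)

section Hyps
variable {P : ℕ → Set ℝ} {ℓ : ℝ → ℕ} {ν T : ℝ}

/-! ### The weak form is VOID (K54 (4) verbatim): no honest test field survives the junk force -/

/-- A compactly supported multiple `a • U_c` (`c > 0`) of a dilate of the profile vanishes identically:
`U` is NOT compactly supported (`Profile.far`), so `a = 0` or the support is unbounded. -/
theorem eq_zero_of_eq_smul_dilate {c a : ℝ} (hc : 0 < c) {φ : (EuclideanSpace ℝ (Fin 3)) → (EuclideanSpace ℝ (Fin 3))} (hφ : HasCompactSupport φ)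
    (h : φ = a • dilate c Pr.U) : φ = 0 := by
  by_cases ha : a = 0
  · rw [h, ha, zero_smul]
  · exfalso
    obtain ⟨y, hy, hUy⟩ :=
      Pr.far ((fun x : (EuclideanSpace ℝ (Fin 3)) => c • x) '' tsupport φ) (hφ.isCompact.image (continuous_const_smul c))
    have hx : c⁻¹ • y ∉ tsupport φ := fun hmem => hy ⟨c⁻¹ • y, hmem, smul_inv_smul₀ hc.ne' y⟩
    have h0 : φ (c⁻¹ • y) = 0 := image_eq_zero_of_notMem_tsupport hx
    rw [h, Pi.smul_apply, JunkBuild.dilate_apply, smul_inv_smul₀ hc.ne'] at h0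
    exact smul_ne_zero ha (smul_ne_zero (Real.sqrt_pos.2 hc).ne' (smul_ne_zero hc.ne' hUy)) h0

/-- Joint continuity of the slice derivatives `(t, x) ↦ D(ψ t)(x)` of a space–time test field. -/
theorem continuous_fderiv_slice_test {Q : TopologicalSpace.Opens (ℝ × (EuclideanSpace ℝ (Fin 3)))} {ψ : ℝ → (EuclideanSpace ℝ (Fin 3)) → (EuclideanSpace ℝ (Fin 3))}
    (hψ : IsSpaceTimeTestOn Q ψ) : Continuous fun z : ℝ × (EuclideanSpace ℝ (Fin 3)) => fderiv ℝ (ψ z.1) z.2 := by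
  have h := ((hψ.isSmoothSpaceTimeOn univ).fderiv_slice uniqueDiffOn_univ).continuousOn
  rw [univ_prod_univ, continuousOn_univ] at h
  exact h

/-- Joint continuity of the slice Laplacian `(t, x) ↦ Δ(ψ t)(x)` of a space–time test field. -/
theorem continuous_laplacian_slice_test {Q : TopologicalSpace.Opens (ℝ × (EuclideanSpace ℝ (Fin 3)))} {ψ : ℝ → (EuclideanSpace ℝ (Fin 3)) → (EuclideanSpace ℝ (Fin 3))}
    (hψ : IsSpaceTimeTestOn Q ψ) : Continuous fun z : ℝ × (EuclideanSpace ℝ (Fin 3)) => Δ (ψ z.1) z.2 := by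
  have h := ((hψ.isSmoothSpaceTimeOn univ).laplacian uniqueDiffOn_univ).continuousOn
  rw [univ_prod_univ, continuousOn_univ] at h
  exact h

/-- The honest part `⟪u, ∂ₜψ⟫ + ⟪u, (u·∇)ψ⟫ + ν⟪u, Δψ⟫ + ⟪κ U_λ, ψ⟫` of the weak-form integrand of the
witness is integrable in `x` for each `t` (continuous, supported in the `x`-shadow of `tsupport ψ`). -/
theorem integrable_honest_uW {ψ : ℝ → (EuclideanSpace ℝ (Fin 3)) → (EuclideanSpace ℝ (Fin 3))}
    (hψ : IsSpaceTimeTestOn (slab (EuclideanSpace ℝ (Fin 3)) (Iio T) isOpen_Iio) ψ) (ν t : ℝ) :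
    Integrable (fun x => ⟪uW Pr T t x, timeDeriv ψ t x⟫ +
      ⟪uW Pr T t x, convect (uW Pr T t) (ψ t) x⟫ + ν * ⟪uW Pr T t x, Δ (ψ t) x⟫ +
      ⟪kappa Pr ν T t • dilate (lam T t) Pr.U x, ψ t x⟫) := by
  obtain ⟨K, hK, hKt⟩ := hψ.exists_compact_slice_subset
  have hu : Continuous (uW Pr T t) := (contDiff_uW (Pr := Pr) T t).continuous
  have h1 : Continuous fun x => timeDeriv ψ t x :=
    hψ.continuous_timeDeriv.comp (continuous_const.prodMk continuous_id')
  have h2 : Continuous fun x => convect (uW Pr T t) (ψ t) x := by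
    -- (no expected-type propagation through `Δ`/`fderiv`: `whnf` of the slice Laplacian is expensive)
    have h := ((continuous_fderiv_slice_test hψ).comp (Continuous.prodMk_right t)).clm_apply hu
    exact h
  have h3 : Continuous fun x => Δ (ψ t) x := by
    have h := (continuous_laplacian_slice_test hψ).comp (Continuous.prodMk_right t)
    exact h
  have h4 : Continuous (ψ t) := (hψ.contDiff_slice t).continuous
  have h5 : Continuous fun x => kappa Pr ν T t • dilate (lam T t) Pr.U x := by
    have hd := JunkBuild.continuous_dilate Pr (lam T t)
    fun_prop
  have hc : Continuous (fun x => ⟪uW Pr T t x, timeDeriv ψ t x⟫ +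
      ⟪uW Pr T t x, convect (uW Pr T t) (ψ t) x⟫ + ν * ⟪uW Pr T t x, Δ (ψ t) x⟫ +
      ⟪kappa Pr ν T t • dilate (lam T t) Pr.U x, ψ t x⟫) :=
    (((hu.inner h1).add (hu.inner h2)).add (continuous_const.mul (hu.inner h3))).add (h5.inner h4)
  refine hc.integrable_of_hasCompactSupport (HasCompactSupport.intro hK fun x hx => ?_)
  have hx' : ∀ s, x ∉ tsupport (ψ s) := fun s h => hx (hKt s h)
  have h0 : ∀ s, ψ s x = 0 := fun s => image_eq_zero_of_notMem_tsupport (hx' s)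
  have h6 := timeDeriv_eq_zero_of_forall h0 t
  simp only [timeDeriv_apply] at h6
  simp [h6, convect, fderiv_of_notMem_tsupport ℝ (hx' t), laplacian_eq_zero_of_notMem_tsupport (hx' t),
    h0 t]

/-- The honest part of the weak-form integrand of the witness is jointly measurable in `(t, x)`
(`u` jointly measurable — `measurable_uW` —, the test-field derivatives jointly continuous). -/
theorem measurable_honest_uW {ψ : ℝ → (EuclideanSpace ℝ (Fin 3)) → (EuclideanSpace ℝ (Fin 3))}
    (hψ : IsSpaceTimeTestOn (slab (EuclideanSpace ℝ (Fin 3)) (Iio T) isOpen_Iio) ψ) (ν : ℝ) :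
    Measurable (uncurry fun t x => ⟪uW Pr T t x, timeDeriv ψ t x⟫ +
      ⟪uW Pr T t x, convect (uW Pr T t) (ψ t) x⟫ + ν * ⟪uW Pr T t x, Δ (ψ t) x⟫ +
      ⟪kappa Pr ν T t • dilate (lam T t) Pr.U x, ψ t x⟫) := by
  have hu : Measurable fun z : ℝ × (EuclideanSpace ℝ (Fin 3)) => uW Pr T z.1 z.2 := measurable_uW (Pr := Pr) T
  have h1 : Measurable fun z : ℝ × (EuclideanSpace ℝ (Fin 3)) => timeDeriv ψ z.1 z.2 := hψ.continuous_timeDeriv.measurable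
  have h2 : Measurable fun z : ℝ × (EuclideanSpace ℝ (Fin 3)) => convect (uW Pr T z.1) (ψ z.1) z.2 := by
    have hΦ : Continuous fun q : (ℝ × (EuclideanSpace ℝ (Fin 3))) × (EuclideanSpace ℝ (Fin 3)) => fderiv ℝ (ψ q.1.1) q.1.2 q.2 :=
      ((continuous_fderiv_slice_test hψ).comp continuous_fst).clm_apply continuous_snd
    exact hΦ.measurable.comp (measurable_id.prodMk hu)
  have h3 : Measurable fun z : ℝ × (EuclideanSpace ℝ (Fin 3)) => Δ (ψ z.1) z.2 := (continuous_laplacian_slice_test hψ).measurable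
  have h4 : Measurable fun z : ℝ × (EuclideanSpace ℝ (Fin 3)) => ψ z.1 z.2 := hψ.contDiff.continuous.measurable
  have hl : Measurable fun z : ℝ × (EuclideanSpace ℝ (Fin 3)) => lam T z.1 := (measurable_lam T).comp measurable_fst
  have hk : Measurable fun z : ℝ × (EuclideanSpace ℝ (Fin 3)) => kappa Pr ν T z.1 := by
    have hls : Measurable fun z : ℝ × (EuclideanSpace ℝ (Fin 3)) => lamSq T z.1 := (measurable_lamSq T).comp measurable_fst
    unfold kappa
    exact measurable_const.add (((measurable_const.mul measurable_fst).mul hls).mul measurable_const)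
  have hd : Measurable fun z : ℝ × (EuclideanSpace ℝ (Fin 3)) => dilate (lam T z.1) Pr.U z.2 :=
    (JunkBuild.continuous_dilate₂ Pr).measurable.comp (hl.prodMk measurable_snd)
  exact (((hu.inner h1).add (hu.inner h2)).add ((hu.inner h3).const_mul ν)).add ((hk.smul hd).inner h4)

/-- The junk pairing `t ↦ ∫ ⟪Φ_{λ(t), m}, ψ(t)⟫` is measurable for each `m` (`J.measurable`, `λ`
measurable, `ψ` jointly continuous; `StronglyMeasurable.integral_prod_right`). -/
theorem measurable_junkPairing_uW {ψ : ℝ → (EuclideanSpace ℝ (Fin 3)) → (EuclideanSpace ℝ (Fin 3))}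
    (hψ : IsSpaceTimeTestOn (slab (EuclideanSpace ℝ (Fin 3)) (Iio T) isOpen_Iio) ψ) (m : ℕ) :
    Measurable fun t => ∫ x, ⟪J.Φ (lam T t) m x, ψ t x⟫ := by
  have hΦ : Measurable fun z : ℝ × (EuclideanSpace ℝ (Fin 3)) => J.Φ (lam T z.1) m z.2 :=
    (J.measurable m).comp (((measurable_lam T).comp measurable_fst).prodMk measurable_snd)
  have hc : Measurable (uncurry fun t x => ⟪J.Φ (lam T t) m x, ψ t x⟫) :=
    hΦ.inner hψ.contDiff.continuous.measurable
  exact (hc.stronglyMeasurable.integral_prod_right (ν := volume)).measurable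

/-- OBLIGATION 1′ of `isLerayHopfOn_uW`: **THE WEAK-FORM IDENTITY with datum `0` is VOID** (K54 (4)
verbatim, refuter4 `CountableJunkForce.weak_identity_flow` adapted to the time-dependent dilate).
For a test field `ψ` on `(-∞,T) × (EuclideanSpace ℝ (Fin 3))` the slice integrand is `H(t) + P(ℓ(t), t)` with
`H` (`measurable_honest_uW`) and `P(m, ·) = ∫⟪Φ_{λ(·),m}, ψ(·)⟫` (`measurable_junkPairing_uW`)
measurable and `P(0, ·) = 0` (`J.zero`). If the integrand is a.e.-strongly measurable on `(0,T)`,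
the labelling lemma (`SaturatedPartition.lean`, `ae_eq_of_aestronglyMeasurable_label`) makes
`P(ℓ(t),t) = P(m,t)` for every `m` and a.e. `t`, so `ψ(t) ⊥ Φ_{λ(t),m}` for all `m ≥ 1`, so
`ψ(t) = a • U_{λ(t)}` (`J.total`), so `ψ(t) = 0` (`eq_zero_of_eq_smul_dilate`, `Profile.far`) for
a.e. and then (openness) every `t ∈ (0,T)`, and the integrand vanishes on `(0,T)`; otherwise the
Bochner integral is `0` by convention. The divergence-free hypothesis on `ψ` and `hℓ`, `hν`, `hT` are
not used. -/
theorem uW_weakForm (hP : ∀ m (F : Set ℝ), MeasurableSet F → F ⊆ (P m)ᶜ → volume F = 0)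
    (_hℓ : ∀ t, t ∈ P (ℓ t)) (hℓ' : ∀ m, ∀ t ∈ P m, ℓ t = m) (_hν : 0 < ν) (_hT : 0 < T) :
    ∀ ψ : ℝ → (EuclideanSpace ℝ (Fin 3)) → (EuclideanSpace ℝ (Fin 3)), IsSpaceTimeTestOn (slab (EuclideanSpace ℝ (Fin 3)) (Iio T) isOpen_Iio) ψ →
      (∀ t, VectorCalculus.IsDivFree (ψ t)) →
      (∫ t in Ioo 0 T, ∫ x, (⟪uW Pr T t x, timeDeriv ψ t x⟫ +
          ⟪uW Pr T t x, convect (uW Pr T t) (ψ t) x⟫ + ν * ⟪uW Pr T t x, Δ (ψ t) x⟫ +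
          ⟪fW J ℓ ν T t x, ψ t x⟫)) + ∫ x, ⟪(0 : (EuclideanSpace ℝ (Fin 3)) → (EuclideanSpace ℝ (Fin 3))) x, ψ 0 x⟫ = 0 := by
  intro ψ hψ _
  -- notation: honest part `H`, junk pairings `Pk m`, full slice integrand `I`
  set H : ℝ → ℝ := fun t => ∫ x, (⟪uW Pr T t x, timeDeriv ψ t x⟫ +
    ⟪uW Pr T t x, convect (uW Pr T t) (ψ t) x⟫ + ν * ⟪uW Pr T t x, Δ (ψ t) x⟫ +
    ⟪kappa Pr ν T t • dilate (lam T t) Pr.U x, ψ t x⟫) with hH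
  set Pk : ℕ → ℝ → ℝ := fun m t => ∫ x, ⟪J.Φ (lam T t) m x, ψ t x⟫ with hPk
  set I : ℝ → ℝ := fun t => ∫ x, (⟪uW Pr T t x, timeDeriv ψ t x⟫ +
    ⟪uW Pr T t x, convect (uW Pr T t) (ψ t) x⟫ + ν * ⟪uW Pr T t x, Δ (ψ t) x⟫ +
    ⟪fW J ℓ ν T t x, ψ t x⟫) with hI
  have hdatum : ∫ x, ⟪(0 : (EuclideanSpace ℝ (Fin 3)) → (EuclideanSpace ℝ (Fin 3))) x, ψ 0 x⟫ = 0 := by simp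
  rw [hdatum, add_zero]
  show ∫ t in Ioo 0 T, I t = 0
  -- the splitting `I = H + Pk (ℓ t) t`
  have hsplit : ∀ t, I t = H t + Pk (ℓ t) t := by
    intro t
    simp only [hI, hH, hPk]
    rw [← integral_add (integrable_honest_uW hψ ν t)
      (integrable_inner_of_memLp_two (J.memLp _ _) (hψ.memLp_slice t 2))]
    refine integral_congr_ae (Eventually.of_forall fun x => ?_)
    simp only [fW, inner_add_left]
    ring
  have hHm : Measurable H :=
    ((measurable_honest_uW hψ ν).stronglyMeasurable.integral_prod_right (ν := volume)).measurable
  have hPm : ∀ m, Measurable (Pk m) := fun m => measurable_junkPairing_uW J hψ m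
  have hP0 : ∀ t, Pk 0 t = 0 := fun t => by simp [hPk, J.zero]
  by_cases hm : AEStronglyMeasurable I (volume.restrict (Ioo 0 T))
  · -- measurable case: the labelling argument
    have hPl : AEStronglyMeasurable (fun t => Pk (ℓ t) t) (volume.restrict (Ioo 0 T)) := by
      have h' : (fun t => Pk (ℓ t) t) = fun t => I t - H t := by
        funext t; rw [hsplit t]; ring
      rw [h']
      exact hm.sub hHm.aestronglyMeasurable
    have hae : ∀ᵐ t ∂(volume.restrict (Ioo 0 T)), ∀ n, Pk (ℓ t) t = Pk n t :=
      ae_all_iff.2 fun n => ae_eq_of_aestronglyMeasurable_label hP hℓ' hPm measurableSet_Ioo hPl n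
    have hzero : ∀ᵐ t ∂(volume.restrict (Ioo 0 T)), ψ t = 0 := by
      filter_upwards [hae] with t ht
      obtain ⟨a, ha⟩ := J.total (lam T t) (lam_pos T t) (ψ t) (hψ.contDiff_slice t).continuous
        (hψ.hasCompactSupport_slice t) fun m _ => by
          have h' := ht m
          rw [ht 0, hP0 t] at h'
          exact h'.symm
      exact eq_zero_of_eq_smul_dilate (lam_pos T t) (hψ.hasCompactSupport_slice t) ha
    -- every slice in `(0, T)` vanishes: `{t | ψ t ≠ 0} ∩ (0,T)` is open and null
    have hall : ∀ t ∈ Ioo 0 T, ψ t = 0 := by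
      have hopen : IsOpen {t : ℝ | ψ t ≠ 0} := by
        have h' : {t : ℝ | ψ t ≠ 0} = ⋃ x, {t | ψ t x ≠ 0} := by
          ext t
          simp only [mem_setOf_eq, mem_iUnion, ne_eq, funext_iff, Pi.zero_apply, not_forall]
        rw [h']
        exact isOpen_iUnion fun x => isOpen_ne_fun
          (hψ.contDiff.continuous.comp (continuous_id.prodMk continuous_const)) continuous_const
      have hnull : volume ({t : ℝ | ψ t ≠ 0} ∩ Ioo 0 T) = 0 := by
        have h' := ae_iff.1 hzero
        rwa [Measure.restrict_apply' measurableSet_Ioo] at h'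
      intro t ht
      by_contra hne
      exact ((hopen.inter isOpen_Ioo).measure_pos volume ⟨t, hne, ht⟩).ne' hnull
    -- hence the integrand vanishes on `(0, T)`
    have hIt : ∀ t ∈ Ioo 0 T, I t = 0 := by
      intro t ht
      refine integral_eq_zero_of_ae (Eventually.of_forall fun x => ?_)
      have hnot := ForcedUniquenessCountableJunk.notMem_tsupport_of_forall_slice_eq_zero hall ht x
      have hΔ : Δ (ψ t) x = 0 := by
        rw [hall t ht]
        show Δ (fun _ : (EuclideanSpace ℝ (Fin 3)) => (0 : (EuclideanSpace ℝ (Fin 3)))) x = 0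
        rw [InnerProductSpace.laplacian_const]
        rfl
      have h1 := timeDeriv_eq_zero_of_notMem_tsupport hnot
      simp only [timeDeriv_apply] at h1
      simp [h1, convect, fderiv_slice_eq_zero_of_notMem_tsupport hnot,
        apply_eq_zero_of_notMem_tsupport hnot, hΔ]
    rw [setIntegral_congr_fun measurableSet_Ioo hIt]
    simp
  · exact integral_non_aestronglyMeasurable hm

/-- OBLIGATION 1 of `isLerayHopfOn_uW`: the weak form with datum `0` — conjuncts 1–3 (measurability,
local square integrability, divergence-free slices) and the VOID identity `uW_weakForm` (conjunct 4). -/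
theorem uW_weak (hP : ∀ m (F : Set ℝ), MeasurableSet F → F ⊆ (P m)ᶜ → volume F = 0)
    (hℓ : ∀ t, t ∈ P (ℓ t)) (hℓ' : ∀ m, ∀ t ∈ P m, ℓ t = m) (hν : 0 < ν) (hT : 0 < T) :
    IsWeakNSSolutionOn T ν (fW J ℓ ν T) 0 (uW Pr T) :=
  ⟨aestronglyMeasurable_uW T, fun K _ => lintegral_uW_sq_lt_top T K, ae_isWeaklyDivFree_uW T,
    uW_weakForm J hP hℓ hℓ' hν hT⟩

end Hyps

end Summit.NavierStokesRegularity.ForcedUniquenessHygiene.KJ6
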